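import Literature.Geometry.Kaehler.ComplexTorusHomologicalNumericalEquivalence
import Literature.Geometry.Kaehler.ComplexTorusAmpleHypersurfaceCurveCriterion
import Literature.Geometry.Kaehler.ComplexTorusAnalyticIntersectionNumber
import HarnessLib

/-!
# The class of an analytic hypersurface of an abelian variety is determined by the number of points in
# which its general translates meet each curve; ampleness is decided by a general translate meeting every curve

Layer `Literature/Geometry/Kaehler`, namespace `Literature.Geometry.Kaehler.ComplexTorus`; lane
`lit-hodgefound`, seat p07 (generation 42), programme «NUMERICAL EQUIVALENCE», file 39 — the point-count
form of file 38 (`ComplexTorusHomologicalNumericalEquivalence`: on an abelian variety two hypersurfaces have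
the same class iff they have the same intersection number `∫_C [D]` with every irreducible curve), through the
seat's «INTERSECTION NUMBERS ARE POINT COUNTS» (`ComplexTorusAnalyticIntersectionNumber`:
`[Y₁]_e ∧ [Y₂]_e = #(Y₁ ∩ (Y₂ − t)) · vol_e` for almost every `t`, complementary dimensions) and the curve
criterion for ampleness (`ComplexTorusAmpleHypersurfaceCurveCriterion`, file 34). Theorems only (no
definition, no named fact; net debt `0`).

SETTING. `X = E/Λ` a compact complex torus of dimension `g = q + 1 ≥ 1`, `e : Fin (2g) ≃ ι`; `C ⊆ X` a
closed analytic subset of pure dimension `1` (a curve), `D ⊆ X` one of pure dimension `q` (a hypersurface);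
`[C]_e ∈ H^{2q}(X, ℂ)`, `[D]_e ∈ H²(X, ℂ)` their classes; `∫_C [D]_e = analyticCyclePeriod Φ hC [D]_e`
(`= ∫_D [C]_e = ⟨[D]_e, [C]_e⟩_e`, the intersection number `(D · C)` up to `sign(e)`); `D − t = (· + t)⁻¹' D`.

## Contents

* §1 **`ae_finite_and_analyticCyclePeriod_eq_orientationSign_mul_ncard`** — for Haar-almost every `t ∈ X`
  the set `C ∩ (D − t)` is finite and **`∫_C [D]_e = sign(e) · #(C ∩ (D − t))`**: the degree of `D` on `C` is
  the number of points of `C` on a general translate of `D`, each counted once (Fulton, Example 11.4.5 /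
  (8.8); Kleiman's transversality of a general translate; Griffiths–Harris Ch. 0 §4); consequently
  `exists_nat_analyticCyclePeriod_eq_orientationSign_mul` (`(D · C) ∈ ℕ`) — on ANY compact complex torus.
* §2 **`IsAbelianVariety.analyticCycleClass_hypersurface_eq_iff_forall_curve_ae_ncard_eq`** — on an abelian
  variety, `[D₁]_e = [D₂]_e ⟺` for every irreducible analytic curve `C`,
  `#(C ∩ (D₁ − t)) = #(C ∩ (D₂ − t))` for almost every `t` (file 38 §5 + §1): THE COHOMOLOGY CLASS OF A
  HYPERSURFACE IS THE FUNCTION "GENERIC NUMBER OF INTERSECTION POINTS WITH EACH CURVE".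
* §3 **`IsAbelianVariety.torusIntegral_wedgePow_ne_zero_iff_forall_curve_analyticCyclePeriod_ne_zero`** —
  on an abelian variety `(D^g) ≠ 0 ⟺ ∫_C [D]_e ≠ 0` (`(D · C) ≥ 1`) for every irreducible curve `C`
  (Nakai–Moishezon on curves, Hartshorne Thm. 5.1, in the period form), and
  **`IsAbelianVariety.torusIntegral_wedgePow_ne_zero_iff_forall_curve_ae_inter_translate_nonempty`** —
  `(D^g) ≠ 0 ⟺` a GENERAL translate of `D` meets every irreducible curve (file 34 asks it of every translate;
  for a curve missed by one translate `D − t₀` is missed by almost all, `∫_C [D] = 0`).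

## References

* [Fulton1998] W. Fulton, *Intersection Theory*, 2nd ed., Springer 1998, §8.2 (8.8), Example 11.4.5, §12.2,
  §19.3 Example 19.3.3.
* [Kleiman1974Transversality] S. L. Kleiman, *The transversality of a general translate*, Compositio Math.
  28 (1974), Thm. 2.
* [GriffithsHarris1978] P. Griffiths, J. Harris, *Principles of Algebraic Geometry*, Wiley 1978, Ch. 0 §4.
* [Hartshorne1970] R. Hartshorne, *Ample Subvarieties of Algebraic Varieties*, LNM 156 (1970), Ch. I §5
  Thm. 5.1, §6 (p. 28).
* [Lange2023AbelianVarietiesComplex] H. Lange, *Abelian Varieties over the Complex Numbers*, Springer 2023,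
  §2.1.3 Prop. 2.1.11, §4.6.3 Thm. 4.6.14, §6.2.5 Exercise (10).
-/

noncomputable section

open scoped Manifold Topology Pointwise
open MeasureTheory Set Function Filter Module

namespace Literature.Geometry.Kaehler

namespace ComplexTorus

universe u

variable {ι : Type*} [Fintype ι] [DecidableEq ι] {E : Type u} [NormedAddCommGroup E] [InnerProductSpace ℂ E]
  [FiniteDimensional ℂ E] [MeasurableSpace E] [BorelSpace E] (Φ : (ι → ℝ) ≃L[ℝ] E) {g q : ℕ}
  (e : Fin (2 * g) ≃ ι)

omit [Fintype ι] [InnerProductSpace ℂ E] [FiniteDimensional ℂ E] [MeasurableSpace E] [BorelSpace E] in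
/-- The orientation sign does not see a re-reading of the degree. [folklore] -/
private theorem orientationSign_finCongr_trans₃₉ {ι' F : Type*} [DecidableEq ι'] [NormedAddCommGroup F]
    [NormedSpace ℂ F] (Ψ : (ι' → ℝ) ≃L[ℝ] F) {n N : ℕ} (h : n = N) (f : Fin N ≃ ι') :
    orientationSign Ψ ((finCongr h).trans f) = orientationSign Ψ f := by
  subst h; rfl

/-! ### §1 `∫_C [D] = sign(e) · #(C ∩ (D − t))` for almost every `t` -/

section PointCount

/-- **`∫_C [D]_e = sign(e) · #(C ∩ (D − t))` for Haar-almost every `t`**, on any compact complex torus of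
dimension `g = q + 1`: for a closed analytic curve `C` and a closed analytic hypersurface `D`, almost every
translate `D − t = (· + t)⁻¹' D` meets `C` in finitely many points, and their number is the intersection
number `∫_C [D]_e` up to the orientation sign of `e` (`[C]_e ∧ [D]_e = #(C ∩ (D − t)) · vol`,
`ae_finite_inter_translate_and_wedge_eq_ncard_smul_volumeForm`, integrated over `X`).
[cite: Fulton1998, §8.2 (8.8) and Example 11.4.5] [cite: Kleiman1974Transversality, Thm. 2] [cite: GriffithsHarris1978, Ch. 0 §4] -/
theorem ae_finite_and_analyticCyclePeriod_eq_orientationSign_mul_ncard (hq : 1 + q = g)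
    (hC' : 2 * 1 + 2 * q = 2 * g) (hD' : 2 * q + 2 * 1 = 2 * g) {C D : Set (ComplexTorus Φ)}
    (hC : HasPureDim 𝓘(ℂ, E) C 1) (hD : HasPureDim 𝓘(ℂ, E) D q) :
    ∀ᵐ t ∂(volume : Measure (ComplexTorus Φ)),
      (C ∩ (fun x ↦ x + t) ⁻¹' D).Finite ∧
        analyticCyclePeriod Φ hC (analyticCycleClass Φ e hD' hD) =
          (orientationSign Φ e : ℂ) * ((C ∩ (fun x ↦ x + t) ⁻¹' D).ncard : ℂ) := by
  have hg : finrank ℂ E = g := finrank_eq_of_finTwoMulEquiv Φ e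
  have hE : 0 < finrank ℂ E := by omega
  have h0 : 2 * 0 + 2 * (q + 1) = 2 * g := by omega
  have hN : 2 * (q + 1) = 2 * g := by omega
  have hss : ((orientationSign Φ e : ℤ) : ℂ) * orientationSign Φ e = 1 := by
    exact_mod_cast orientationSign_mul_self Φ e
  filter_upwards [ae_finite_inter_translate_and_wedge_eq_ncard_smul_volumeForm Φ e hE hC' hD' h0 hC hD]
    with t ht
  refine ⟨ht.1, ?_⟩
  have hI := congrArg (torusIntegral Φ ((finCongr hN).trans e)) ht.2
  rw [torusIntegral_smul_volumeForm, torusIntegral_finCongr_trans, domDomCongr_finCongr_trans,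
    torusIntegral_domDomCongr_wedge_eq_orientationSign_mul_poincarePairing Φ e hD',
    poincarePairing_analyticCycleClass, analyticCyclePeriod_analyticCycleClass_comm Φ e hC' hD' hC hD,
    orientationSign_finCongr_trans₃₉] at hI
  calc analyticCyclePeriod Φ hC (analyticCycleClass Φ e hD' hD)
      = (orientationSign Φ e : ℂ) * ((orientationSign Φ e : ℂ) *
          analyticCyclePeriod Φ hC (analyticCycleClass Φ e hD' hD)) := by rw [← mul_assoc, hss, one_mul]
    _ = (orientationSign Φ e : ℂ) * ((C ∩ (fun x ↦ x + t) ⁻¹' D).ncard : ℂ) := by rw [hI]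

/-- For a POSITIVELY ORIENTED enumeration: `∫_C [D]_e = #(C ∩ (D − t))` for almost every `t`.
[cite: Fulton1998, §8.2 (8.8) and Example 11.4.5] [cite: Kleiman1974Transversality, Thm. 2] -/
theorem ae_finite_and_analyticCyclePeriod_eq_ncard (he : orientationSign Φ e = 1) (hq : 1 + q = g)
    (hC' : 2 * 1 + 2 * q = 2 * g) (hD' : 2 * q + 2 * 1 = 2 * g) {C D : Set (ComplexTorus Φ)}
    (hC : HasPureDim 𝓘(ℂ, E) C 1) (hD : HasPureDim 𝓘(ℂ, E) D q) :
    ∀ᵐ t ∂(volume : Measure (ComplexTorus Φ)),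
      (C ∩ (fun x ↦ x + t) ⁻¹' D).Finite ∧
        analyticCyclePeriod Φ hC (analyticCycleClass Φ e hD' hD) = ((C ∩ (fun x ↦ x + t) ⁻¹' D).ncard : ℂ) := by
  filter_upwards [ae_finite_and_analyticCyclePeriod_eq_orientationSign_mul_ncard Φ e hq hC' hD' hC hD]
    with t ht
  exact ⟨ht.1, by rw [ht.2, he, Int.cast_one, one_mul]⟩

/-- **`(D · C)` is a non-negative integer**: `∫_C [D]_e = sign(e) · n` for some `n ∈ ℕ` (the number of
points of `C` on a general translate of `D`). [cite: Fulton1998, §8.2 (8.8), Example 11.4.5 and §12.2] -/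
theorem exists_nat_analyticCyclePeriod_eq_orientationSign_mul (hq : 1 + q = g) (hC' : 2 * 1 + 2 * q = 2 * g)
    (hD' : 2 * q + 2 * 1 = 2 * g) {C D : Set (ComplexTorus Φ)} (hC : HasPureDim 𝓘(ℂ, E) C 1)
    (hD : HasPureDim 𝓘(ℂ, E) D q) :
    ∃ n : ℕ, analyticCyclePeriod Φ hC (analyticCycleClass Φ e hD' hD) = (orientationSign Φ e : ℂ) * n := by
  obtain ⟨t, -, ht⟩ :=
    (ae_finite_and_analyticCyclePeriod_eq_orientationSign_mul_ncard Φ e hq hC' hD' hC hD).exists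
  exact ⟨_, ht⟩

/-- **A translate `D − t` meeting the curve `C` in finitely many points meets it in at most `(D · C)`
points, for almost every `t` with EQUALITY** — here the a.e. statement in the form
`sign(e) · ∫_C [D]_e = #(C ∩ (D − t))`. [cite: Fulton1998, §8.2 (8.8) and Example 11.4.5] -/
theorem ae_orientationSign_mul_analyticCyclePeriod_eq_ncard (hq : 1 + q = g) (hC' : 2 * 1 + 2 * q = 2 * g)
    (hD' : 2 * q + 2 * 1 = 2 * g) {C D : Set (ComplexTorus Φ)} (hC : HasPureDim 𝓘(ℂ, E) C 1)
    (hD : HasPureDim 𝓘(ℂ, E) D q) :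
    ∀ᵐ t ∂(volume : Measure (ComplexTorus Φ)),
      (C ∩ (fun x ↦ x + t) ⁻¹' D).Finite ∧
        (orientationSign Φ e : ℂ) * analyticCyclePeriod Φ hC (analyticCycleClass Φ e hD' hD) =
          ((C ∩ (fun x ↦ x + t) ⁻¹' D).ncard : ℂ) := by
  have hss : ((orientationSign Φ e : ℤ) : ℂ) * orientationSign Φ e = 1 := by
    exact_mod_cast orientationSign_mul_self Φ e
  filter_upwards [ae_finite_and_analyticCyclePeriod_eq_orientationSign_mul_ncard Φ e hq hC' hD' hC hD]
    with t ht
  exact ⟨ht.1, by rw [ht.2, ← mul_assoc, hss, one_mul]⟩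

end PointCount

/-! ### §2 On an abelian variety the class of a hypersurface is determined by its generic point counts on curves -/

section Classes

/-- **THE CLASS OF A HYPERSURFACE OF AN ABELIAN VARIETY IS DETERMINED BY THE NUMBER OF POINTS IN WHICH ITS
GENERAL TRANSLATES MEET EACH CURVE.** For closed analytic hypersurfaces `D₁, D₂` of an abelian variety `X` of
dimension `g = q + 1`: `[D₁]_e = [D₂]_e` in `H²(X, ℂ)` iff for every irreducible analytic curve `C ⊆ X` and
Haar-almost every `t ∈ X`, `#(C ∩ (D₁ − t)) = #(C ∩ (D₂ − t))`. (`⇐`: the counts are the intersection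
numbers `∫_C [Dᵢ]` (§1), which determine the class — numerical = homological equivalence for divisors on
an abelian variety, `IsAbelianVariety.analyticCycleClass_hypersurface_eq_iff_forall_curve`.)
[cite: Fulton1998, Example 11.4.5 and §19.3 Example 19.3.3] [cite: Hartshorne1970, Ch. I §6 (p. 28)]
[cite: Lange2023AbelianVarietiesComplex, §6.2.5 Exercise (10)] -/
theorem IsAbelianVariety.analyticCycleClass_hypersurface_eq_iff_forall_curve_ae_ncard_eq
    (hX : IsAbelianVariety Φ) (hq : 1 + q = g) (hD' : 2 * q + 2 * 1 = 2 * g) {D₁ D₂ : Set (ComplexTorus Φ)}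
    (hD₁ : HasPureDim 𝓘(ℂ, E) D₁ q) (hD₂ : HasPureDim 𝓘(ℂ, E) D₂ q) :
    analyticCycleClass Φ e hD' hD₁ = analyticCycleClass Φ e hD' hD₂ ↔
      ∀ (C : Set (ComplexTorus Φ)), HasPureDim 𝓘(ℂ, E) C 1 → IsIrreducibleAnalyticSet 𝓘(ℂ, E) C →
        ∀ᵐ t ∂(volume : Measure (ComplexTorus Φ)),
          (C ∩ (fun x ↦ x + t) ⁻¹' D₁).ncard = (C ∩ (fun x ↦ x + t) ⁻¹' D₂).ncard := by
  have hC' : 2 * 1 + 2 * q = 2 * g := by omega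
  have hsign : (orientationSign Φ e : ℂ) ≠ 0 := by
    rcases orientationSign_eq_or Φ e with hs | hs <;> rw [hs] <;> norm_num
  constructor
  · intro h C hC _
    filter_upwards [ae_finite_and_analyticCyclePeriod_eq_orientationSign_mul_ncard Φ e hq hC' hD' hC hD₁,
      ae_finite_and_analyticCyclePeriod_eq_orientationSign_mul_ncard Φ e hq hC' hD' hC hD₂] with t h₁ h₂
    have h12 : (orientationSign Φ e : ℂ) * ((C ∩ (fun x ↦ x + t) ⁻¹' D₁).ncard : ℂ) =
        (orientationSign Φ e : ℂ) * ((C ∩ (fun x ↦ x + t) ⁻¹' D₂).ncard : ℂ) := by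
      rw [← h₁.2, ← h₂.2, h]
    exact_mod_cast mul_left_cancel₀ hsign h12
  · intro h
    refine (hX.analyticCycleClass_hypersurface_eq_iff_forall_curve Φ e hq hD' hD₁ hD₂).2 fun C hC hCi ↦ ?_
    obtain ⟨t, ht, h₁, h₂⟩ := ((h C hC hCi).and
      ((ae_finite_and_analyticCyclePeriod_eq_orientationSign_mul_ncard Φ e hq hC' hD' hC hD₁).and
        (ae_finite_and_analyticCyclePeriod_eq_orientationSign_mul_ncard Φ e hq hC' hD' hC hD₂))).exists
    rw [h₁.2, h₂.2, ht]

/-- The same with translates written `t + D` (`(· + t)⁻¹' D = (−t) + D` and `t ↦ −t` preserves Haar measure).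
[cite: Fulton1998, Example 11.4.5 and §19.3 Example 19.3.3] [cite: Hartshorne1970, Ch. I §6 (p. 28)] -/
theorem IsAbelianVariety.analyticCycleClass_hypersurface_eq_iff_forall_curve_ae_ncard_vadd_eq
    (hX : IsAbelianVariety Φ) (hq : 1 + q = g) (hD' : 2 * q + 2 * 1 = 2 * g) {D₁ D₂ : Set (ComplexTorus Φ)}
    (hD₁ : HasPureDim 𝓘(ℂ, E) D₁ q) (hD₂ : HasPureDim 𝓘(ℂ, E) D₂ q) :
    analyticCycleClass Φ e hD' hD₁ = analyticCycleClass Φ e hD' hD₂ ↔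
      ∀ (C : Set (ComplexTorus Φ)), HasPureDim 𝓘(ℂ, E) C 1 → IsIrreducibleAnalyticSet 𝓘(ℂ, E) C →
        ∀ᵐ t ∂(volume : Measure (ComplexTorus Φ)), (C ∩ (t +ᵥ D₁)).ncard = (C ∩ (t +ᵥ D₂)).ncard := by
  have hpre : ∀ (D : Set (ComplexTorus Φ)) (s : ComplexTorus Φ), (fun x ↦ x + s) ⁻¹' D = -s +ᵥ D := by
    intro D s
    ext x
    rw [mem_preimage, Set.mem_vadd_set_iff_neg_vadd_mem, neg_neg, vadd_eq_add, add_comm]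
  rw [hX.analyticCycleClass_hypersurface_eq_iff_forall_curve_ae_ncard_eq Φ e hq hD' hD₁ hD₂]
  refine forall₃_congr fun C _ _ ↦ ?_
  simp only [hpre]
  constructor
  · intro h
    rw [ae_iff] at h ⊢
    rw [← Measure.measure_preimage_neg (volume : Measure (ComplexTorus Φ))]
    simpa only [preimage_setOf_eq, neg_neg] using h
  · intro h
    rw [ae_iff] at h ⊢
    rw [← Measure.measure_preimage_neg (volume : Measure (ComplexTorus Φ))] at h
    simpa only [preimage_setOf_eq] using h

end Classes

/-! ### §3 Ampleness of a hypersurface of an abelian variety is decided by a general translate meeting every curve -/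

section Ample

/-- `[C]_e ∧ [D]_e = 0 ⇒ ∫_C [D]_e = 0` (the top form `[C] ∧ [D]` integrates to `sign(e) ∫_D [C] = sign(e) ∫_C [D]`),
on any compact complex torus. [cite: Fulton1998, §8.2 (8.8) and §12.2] -/
theorem analyticCyclePeriod_eq_zero_of_wedge_eq_zero (hC' : 2 * 1 + 2 * q = 2 * g) (hD' : 2 * q + 2 * 1 = 2 * g)
    {C D : Set (ComplexTorus Φ)} (hC : HasPureDim 𝓘(ℂ, E) C 1) (hD : HasPureDim 𝓘(ℂ, E) D q)
    (h0 : (analyticCycleClass Φ e hC' hC).wedge (analyticCycleClass Φ e hD' hD) = 0) :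
    analyticCyclePeriod Φ hC (analyticCycleClass Φ e hD' hD) = 0 := by
  rw [← analyticCyclePeriod_analyticCycleClass_comm Φ e hC' hD' hC hD, ← poincarePairing_analyticCycleClass Φ e hD' hD,
    ← torusIntegral_domDomCongr_wedge_eq_zero_iff Φ e hD', h0, ContinuousAlternatingMap.domDomCongr_zero, torusIntegral_zero]

/-- **NAKAI–MOISHEZON ON CURVES, period form: on an abelian variety `(D^g) ≠ 0 ⟺ (D · C) ≠ 0` — i.e.
`∫_C [D]_e ≠ 0` — for every irreducible analytic curve `C`** (file 34's `[C]_e ∧ [D]_e ≠ 0` read as a number: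
`∫_C [D]_e = sign(e) · #(C ∩ (D − t))` for almost every `t`, §1). [cite: Hartshorne1970, Ch. I §5 Thm. 5.1 and §6]
[cite: Lange2023AbelianVarietiesComplex, §2.1.3 Prop. 2.1.11 and §4.6.2 Lemma 4.6.4] [cite: Fulton1998, Example 11.4.5 and §12.2] -/
theorem IsAbelianVariety.torusIntegral_wedgePow_ne_zero_iff_forall_curve_analyticCyclePeriod_ne_zero
    (hX : IsAbelianVariety Φ) (hq : 1 + q = g) (hD' : 2 * q + 2 * 1 = 2 * g) {D : Set (ComplexTorus Φ)}
    (hD : HasPureDim 𝓘(ℂ, E) D q) :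
    torusIntegral Φ e (wedgePow (analyticCycleClass Φ e hD' hD) g) ≠ 0 ↔
      ∀ (C : Set (ComplexTorus Φ)) (hC : HasPureDim 𝓘(ℂ, E) C 1), IsIrreducibleAnalyticSet 𝓘(ℂ, E) C →
        analyticCyclePeriod Φ hC (analyticCycleClass Φ e hD' hD) ≠ 0 := by
  have hC' : 2 * 1 + 2 * q = 2 * g := by omega
  have hsign : (orientationSign Φ e : ℂ) ≠ 0 := by
    rcases orientationSign_eq_or Φ e with hs | hs <;> rw [hs] <;> norm_num
  have hpre : ∀ s : ComplexTorus Φ, (fun x ↦ x + s) ⁻¹' D = -s +ᵥ D := by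
    intro s
    ext x
    rw [mem_preimage, Set.mem_vadd_set_iff_neg_vadd_mem, neg_neg, vadd_eq_add, add_comm]
  constructor
  · intro hDg C hC hCi
    -- every translate of `D` meets `C`; a general one meets it in `sign(e) ∫_C [D]` points
    have hall := (hX.torusIntegral_wedgePow_ne_zero_iff_forall_curve_inter_vadd_nonempty Φ e hD' hD).1 hDg C
      hCi hC
    obtain ⟨t, hfin, ht⟩ :=
      (ae_finite_and_analyticCyclePeriod_eq_orientationSign_mul_ncard Φ e hq hC' hD' hC hD).exists
    rw [ht]
    refine mul_ne_zero hsign ?_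
    have hne : (C ∩ (fun x ↦ x + t) ⁻¹' D).Nonempty := by rw [hpre]; exact hall (-t)
    exact_mod_cast ((Set.ncard_pos hfin).2 hne).ne'
  · intro h
    refine (hX.torusIntegral_wedgePow_ne_zero_iff_forall_curve_wedge_ne_zero Φ e hD' hC' hD).2
      fun C hC hCi h0 ↦ h C hC hCi ?_
    exact analyticCyclePeriod_eq_zero_of_wedge_eq_zero Φ e hC' hD' hC hD h0

/-- **On an abelian variety a hypersurface `D` is ample (`(D^g) ≠ 0`) iff a GENERAL translate of `D` meets
every irreducible curve**: `(D^g) ≠ 0 ⟺` for every irreducible analytic curve `C`, `C ∩ (D − t) ≠ ∅` for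
Haar-almost every `t` (file 34: iff EVERY translate meets every curve; if one translate misses `C` then
`(D · C) = 0` and almost every translate misses `C`). [cite: Hartshorne1970, Ch. I §5 Thm. 5.1]
[cite: Lange2023AbelianVarietiesComplex, §2.1.3 Prop. 2.1.11 and §4.6.2 Lemma 4.6.4] [cite: Fulton1998, Example 11.4.5 and §12.2] -/
theorem IsAbelianVariety.torusIntegral_wedgePow_ne_zero_iff_forall_curve_ae_inter_translate_nonempty
    (hX : IsAbelianVariety Φ) (hq : 1 + q = g) (hD' : 2 * q + 2 * 1 = 2 * g) {D : Set (ComplexTorus Φ)}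
    (hD : HasPureDim 𝓘(ℂ, E) D q) :
    torusIntegral Φ e (wedgePow (analyticCycleClass Φ e hD' hD) g) ≠ 0 ↔
      ∀ (C : Set (ComplexTorus Φ)), HasPureDim 𝓘(ℂ, E) C 1 → IsIrreducibleAnalyticSet 𝓘(ℂ, E) C →
        ∀ᵐ t ∂(volume : Measure (ComplexTorus Φ)), (C ∩ (fun x ↦ x + t) ⁻¹' D).Nonempty := by
  have hC' : 2 * 1 + 2 * q = 2 * g := by omega
  have hsign : (orientationSign Φ e : ℂ) ≠ 0 := by
    rcases orientationSign_eq_or Φ e with hs | hs <;> rw [hs] <;> norm_num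
  have hpre : ∀ s : ComplexTorus Φ, (fun x ↦ x + s) ⁻¹' D = -s +ᵥ D := by
    intro s
    ext x
    rw [mem_preimage, Set.mem_vadd_set_iff_neg_vadd_mem, neg_neg, vadd_eq_add, add_comm]
  constructor
  · intro hDg C hC hCi
    have hall := (hX.torusIntegral_wedgePow_ne_zero_iff_forall_curve_inter_vadd_nonempty Φ e hD' hD).1 hDg C
      hCi hC
    exact Eventually.of_forall fun t ↦ by rw [hpre]; exact hall (-t)
  · intro h
    refine (hX.torusIntegral_wedgePow_ne_zero_iff_forall_curve_analyticCyclePeriod_ne_zero Φ e hq hD' hD).2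
      fun C hC hCi ↦ ?_
    obtain ⟨t, hne, hfin, ht⟩ :=
      ((h C hC hCi).and (ae_finite_and_analyticCyclePeriod_eq_orientationSign_mul_ncard Φ e hq hC' hD' hC hD)).exists
    rw [ht]
    refine mul_ne_zero hsign ?_
    exact_mod_cast ((Set.ncard_pos hfin).2 hne).ne'

/-- **A degenerate hypersurface (`(D^g) = 0`) of an abelian variety has an irreducible curve `C` with
`(D · C) = 0`, and then almost every translate of `D` misses `C` altogether.** [cite: Lange2023AbelianVarietiesComplex, §2.1.3 Prop. 2.1.11 and §4.6.2 Lemma 4.6.4]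
[cite: Fulton1998, Example 11.4.5 and §12.2] -/
theorem IsAbelianVariety.exists_curve_ae_inter_translate_eq_empty_of_torusIntegral_wedgePow_eq_zero
    (hX : IsAbelianVariety Φ) (hq : 1 + q = g) (hD' : 2 * q + 2 * 1 = 2 * g) {D : Set (ComplexTorus Φ)}
    (hD : HasPureDim 𝓘(ℂ, E) D q) (hDg : torusIntegral Φ e (wedgePow (analyticCycleClass Φ e hD' hD) g) = 0) :
    ∃ (C : Set (ComplexTorus Φ)) (hC : HasPureDim 𝓘(ℂ, E) C 1), IsIrreducibleAnalyticSet 𝓘(ℂ, E) C ∧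
      analyticCyclePeriod Φ hC (analyticCycleClass Φ e hD' hD) = 0 ∧
        ∀ᵐ t ∂(volume : Measure (ComplexTorus Φ)), C ∩ (fun x ↦ x + t) ⁻¹' D = ∅ := by
  have hC' : 2 * 1 + 2 * q = 2 * g := by omega
  have h' : ¬ torusIntegral Φ e (wedgePow (analyticCycleClass Φ e hD' hD) g) ≠ 0 := fun h ↦ h hDg
  rw [hX.torusIntegral_wedgePow_ne_zero_iff_forall_curve_analyticCyclePeriod_ne_zero Φ e hq hD' hD] at h'
  push Not at h'
  obtain ⟨C, hC, hCi, h0⟩ := h'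
  refine ⟨C, hC, hCi, h0, ?_⟩
  filter_upwards [ae_finite_and_analyticCyclePeriod_eq_orientationSign_mul_ncard Φ e hq hC' hD' hC hD]
    with t ht
  have hsign : (orientationSign Φ e : ℂ) ≠ 0 := by
    rcases orientationSign_eq_or Φ e with hs | hs <;> rw [hs] <;> norm_num
  have hn : ((C ∩ (fun x ↦ x + t) ⁻¹' D).ncard : ℂ) = 0 := by
    have := ht.2
    rw [h0] at this
    exact (mul_eq_zero.1 this.symm).resolve_left hsign
  have hn' : (C ∩ (fun x ↦ x + t) ⁻¹' D).ncard = 0 := by exact_mod_cast hn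
  exact (Set.ncard_eq_zero ht.1).1 hn'

end Ample

end ComplexTorus

end Literature.Geometry.Kaehler

end
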